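import Summits.ResolutionOfSingularities.ResolutionOfSingularities.Theorems.ProximityCutJets
import Summits.ResolutionOfSingularities.ResolutionOfSingularities.Theorems.ProximityCutKernels
import Literature.AlgebraicGeometry.Resolution.PointBlowupIFPGiraud
import Mathlib.Algebra.Polynomial.Div
import HarnessLib

/-!
# ProximityCutArcLaw — THE ALL-`e` ARC LAW `ProximityCut.NoFreePointTails` PROVED IN LEAN (port-free kernel proof)
(lens-3 g24 node «ArcLaw», §10; decides route aside 33637 `MaxContactCut.PCArcLawPort` (:= `NoFreePointTails`) and hence
aside 33636 `MaxContactCut.PCNoFreePointTailsDeep` (:= `NoFreePointTailsDeep`, by `ProximityCutKernels.freeTailsDeep_of_all`);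
the by-name wiring is `MaxContactCutArcLaw`)

THE STATEMENT (tree, `ProximityCutClasses.NoFreePointTails`, VERBATIM — nothing re-typed): for every prime power `q = p^e`,
`e ≥ 1`, every perfect field `K` of characteristic `p` and every ROOT state `s₀` (`IsRoot q s₀`), no forced walk
`W : ForcedWalk q s₀` is NEWEST-FREE (`LeavesNewest W t`: chart repeat `j_{t+1} = j_t`, or `b_{t+1}(j_t) ≠ 0`) at every
move `t ≥ N`.

THE PROOF (finite jets along `K[ε]`-valued arcs; §8–§9 of `ProximityCutJets`).
* `walk_chart` — the chart identity of move `t` of a walk from a root: `σ_t F_t = u_{j_t}^q (F_{t+1} − h_t^q)`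
  (`X_pow_mul_chartTransform` with `walk_ord`, the translation `b_t` with `b_t(j_t) = 0` (`onExc`), and the cleaning
  `exists_add_pow_eq_deletePthPowers`).
* `arcPt W T k` — the ARC POINT at level `T − k`: the transversal arc `ε ↦ (u_{j_{T−1}} = ε, others 0)` at a level `T`
  pushed DOWN through the moves (`γ_t = s_t(γ_{t+1})`, `s_t` the affine chart map of move `t`).
* `arcPt_dvd` (η-lemma) — along a newest-free tail every `γ_t ≡ 0 (mod ε)` and the NEWEST coordinate
  `η = (γ_t)_{j_{t−1}}` is `ε·(unit of K[[ε]])`: a chart repeat keeps it, a chart change needs `b_t(j_{t−1}) ≠ 0` and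
  multiplies it by `ε d + b`, a unit.
* `arcPt_jet` (jet invariant) — `ε^{k+1} ∣ (∂^{(d)}F_{T−k})(γ_{T−k})` for all `0 < |d| < q`: at the top because
  `ord F_T ≥ q` and `γ_T ≡ 0`; each move down GAINS `η^q` from the exceptional factor and LOSES `η^{q−1}`
  (`jet_contraction`), net one factor `ε` (cancellation in the domain `K[ε]`).
* `noFreePointTails_holds` (endgame) — at the tail base `B = N+1` the isolation certificate of the forced walk
  (`IsolatedTop`: `g · u_i^M ∈ topIdeal q F_B` for all `i`, `g(0) ≠ 0`), taken at `i = j_N` and evaluated at the arc point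
  `γ_B` pushed down from `T = B + M`, gives `g(γ_B) · (ε·unit)^M ∈ jetIdeal ≤ (ε^{M+1})`, so `ε ∣ g(γ_B)`, so `g(0) = 0`:
  contradiction.  GEOMETRY: a newest-free tail never separates the walk's centres from the image of a transversal arc
  through a deep exceptional point, while the top locus of an isolated singularity cannot contain an arc.
0 sorry; axioms `[propext, Classical.choice, Quot.sound]`; one support definition `arcPt`.  (Sources: Hauser2010
Lecture IX; CossartPiltant2019 (arc/curve termination); CossartJannsenSaito2020 Cor. 5.37.)
-/

open MvPolynomial
open Literature.AlgebraicGeometry.Resolution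

namespace Summit.ResolutionOfSingularities.ResolutionOfSingularities.Theorems.ProximityCut

/-! ## §10 THE ARC LAW — newest-free tails of a forced walk from a root are finite (g24 «ArcLaw») -/

section Walk

variable {K : Type} [Field K] [DecidableEq K]

open TightDefectClasses PointBlowup

omit [DecidableEq K] in
/-- Constant terms under substitution of multiples of `ε = X`: `G(γ)(0) = G(0)`. [folklore] -/
theorem coeff_zero_aeval_of_X_dvd {γ : Fin 3 → Polynomial K} (hγ : ∀ i, Polynomial.X ∣ γ i)
    (G : MvPolynomial (Fin 3) K) : (aeval γ G).coeff 0 = constantCoeff G := by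
  rw [Polynomial.coeff_zero_eq_eval_zero, ← Polynomial.coe_aeval_eq_eval, comp_aeval_apply]
  have hfun : (fun i => Polynomial.aeval (0 : K) (γ i)) = fun _ => (0 : K) := by
    funext i
    rw [Polynomial.coe_aeval_eq_eval, ← Polynomial.coeff_zero_eq_eval_zero]
    exact Polynomial.X_dvd_iff.mp (hγ i)
  rw [hfun, aeval_zero']
  rfl

omit [DecidableEq K] in
/-- `G(0) = 0` and `γ ≡ 0 (mod ε)` give `ε ∣ G(γ)`. [folklore] -/
theorem X_dvd_aeval {γ : Fin 3 → Polynomial K} (hγ : ∀ i, Polynomial.X ∣ γ i) {G : MvPolynomial (Fin 3) K}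
    (hG : constantCoeff G = 0) : Polynomial.X ∣ aeval γ G :=
  Polynomial.X_dvd_iff.mpr (by rw [coeff_zero_aeval_of_X_dvd hγ, hG])

/-- **The chart identity of a move of a forced walk from a root** (`q = p^e`): with `σ_t : u_j ↦ u_j,
u_i ↦ u_j (u_i + b_t i)` (`j = j_t`, `b_t j = 0`), `σ_t F_t = u_j^q · (F_{t+1} − h^q)` for the cleaning polynomial
`h` of the move (`F_{t+1} = deletePthPowers q (F_t^{[j,b]}) = F_t^{[j,b]} + h^q`). [folklore] -/
theorem walk_chart (p : ℕ) [Fact p.Prime] [CharP K p] [PerfectRing K p] {e : ℕ} {s₀ : State (Fin 3) K}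
    (hs : IsRoot (p ^ e) s₀) (W : ForcedWalk (p ^ e) s₀) (t : ℕ) :
    ∃ h : MvPolynomial (Fin 3) K,
      aeval (fun i => if i = W.j t then (X (W.j t) : MvPolynomial (Fin 3) K) else X (W.j t) * (X i + C (W.b t i)))
        (W.st t).F = X (W.j t) ^ p ^ e * ((W.st (t + 1)).F - h ^ p ^ e) := by
  classical
  obtain ⟨h, hh⟩ := exists_add_pow_eq_deletePthPowers p e (pointTransform (p ^ e) (W.j t) (W.b t) (W.st t))
  refine ⟨h, ?_⟩
  have hF : (W.st (t + 1)).F = pointTransform (p ^ e) (W.j t) (W.b t) (W.st t) + h ^ p ^ e := by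
    rw [W.st_succ, hh]
    rfl
  have hb0 : W.b t (W.j t) = 0 := W.onExc t
  have hct := X_pow_mul_chartTransform (W.j t) (ItineraryCutClasses.walk_ord hs W t)
  have hcomp : (aeval fun i => (X i + C (W.b t i) : MvPolynomial (Fin 3) K)).comp
      (aeval fun i => if i = W.j t then (X (W.j t) : MvPolynomial (Fin 3) K) else X (W.j t) * X i) =
      aeval (fun i => if i = W.j t then (X (W.j t) : MvPolynomial (Fin 3) K)
        else X (W.j t) * (X i + C (W.b t i))) := by
    refine MvPolynomial.algHom_ext fun i => ?_
    rw [AlgHom.comp_apply, aeval_X, aeval_X]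
    split_ifs with hi
    · rw [aeval_X, hb0, C_0, add_zero]
    · rw [map_mul, aeval_X, aeval_X, hb0, C_0, add_zero]
  have key := AlgHom.congr_fun hcomp (W.st t).F
  rw [AlgHom.comp_apply] at key
  rw [hF, add_sub_cancel_right, ← key, ← hct, map_mul, map_pow, aeval_X, hb0, C_0, add_zero]
  rfl

variable {q : ℕ} {s₀ : State (Fin 3) K}

/-- **ARC POINTS.**  `arcPt W T k : Fin 3 → K[ε]` is the `K[ε]`-valued point at LEVEL `T − k` of the walk obtained
by pushing the transversal arc `ε ↦ (u_{j_{T−1}} = ε, others 0)` at level `T` DOWN through the moves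
`T−1, T−2, …` (`γ_t = s_t(γ_{t+1})`, `s_t` the chart map of move `t`).  DEFINITION (support). -/
noncomputable def arcPt (W : ForcedWalk q s₀) (T : ℕ) : ℕ → Fin 3 → Polynomial K
  | 0 => fun i => if i = W.j (T - 1) then Polynomial.X else 0
  | k + 1 => fun i =>
      if i = W.j (T - (k + 1)) then arcPt W T k (W.j (T - (k + 1)))
      else arcPt W T k (W.j (T - (k + 1))) *
        (arcPt W T k i + algebraMap K (Polynomial K) (W.b (T - (k + 1)) i))

/-- `arcPt_succ_self`: Auxiliary step of this node's calculus, VERBATIM from the lens file (see the module docstring); the statement is its type. [folklore] -/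
theorem arcPt_succ_self (W : ForcedWalk q s₀) (T k : ℕ) :
    arcPt W T (k + 1) (W.j (T - (k + 1))) = arcPt W T k (W.j (T - (k + 1))) := by
  rw [arcPt]
  exact if_pos rfl

/-- `arcPt_succ_of_ne`: Auxiliary step of this node's calculus, VERBATIM from the lens file (see the module docstring); the statement is its type. [folklore] -/
theorem arcPt_succ_of_ne (W : ForcedWalk q s₀) (T k : ℕ) {i : Fin 3} (hi : i ≠ W.j (T - (k + 1))) :
    arcPt W T (k + 1) i = arcPt W T k (W.j (T - (k + 1))) *
      (arcPt W T k i + algebraMap K (Polynomial K) (W.b (T - (k + 1)) i)) := by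
  rw [arcPt]
  exact if_neg hi

/-- **η-LEMMA.**  Along a NEWEST-FREE tail (levels `≥ N`) every arc point lies over the origin (`ε ∣ γ_t`) and its
NEWEST coordinate `η_{t-1} := (γ_t)_{j_{t−1}}` is `ε ·(unit)`: a chart repeat keeps `η`, a chart change to a point
with `b_t(j_{t−1}) ≠ 0` multiplies it by a unit of `K[[ε]]`. [new] -/
theorem arcPt_dvd (W : ForcedWalk q s₀) (T N : ℕ) (hN : ∀ t, N ≤ t → LeavesNewest W t) :
    ∀ k, N + 1 + k ≤ T → (∀ i, Polynomial.X ∣ arcPt W T k i) ∧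
      ∃ c : Polynomial K, c.coeff 0 ≠ 0 ∧ arcPt W T k (W.j (T - k - 1)) = Polynomial.X * c := by
  intro k
  induction k with
  | zero =>
    intro _
    refine ⟨fun i => ?_, 1, by simp, ?_⟩
    · show Polynomial.X ∣ (if i = W.j (T - 1) then Polynomial.X else 0)
      split_ifs
      · exact dvd_rfl
      · exact dvd_zero _
    · show (if W.j (T - 0 - 1) = W.j (T - 1) then Polynomial.X else 0) = Polynomial.X * 1
      rw [Nat.sub_zero, if_pos rfl, mul_one]
  | succ k ih =>
    intro hT
    obtain ⟨hdiv, c, hc0, hc⟩ := ih (by omega)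
    have ht' : T - k - 1 = T - (k + 1) := by omega
    rw [ht'] at hc
    refine ⟨fun i => ?_, ?_⟩
    · by_cases hi : i = W.j (T - (k + 1))
      · rw [hi, arcPt_succ_self, hc]
        exact dvd_mul_right _ _
      · rw [arcPt_succ_of_ne W T k hi, hc, mul_assoc]
        exact dvd_mul_right _ _
    · have ht1 : T - (k + 1) - 1 + 1 = T - (k + 1) := by omega
      by_cases hjj : W.j (T - (k + 1) - 1) = W.j (T - (k + 1))
      · refine ⟨c, hc0, ?_⟩
        rw [hjj, arcPt_succ_self, hc]
      · have hb : W.b (T - (k + 1)) (W.j (T - (k + 1) - 1)) ≠ 0 := by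
          rcases hN (T - (k + 1) - 1) (by omega) with h1 | h1
          · rw [ht1] at h1
            exact absurd h1.symm hjj
          · rwa [ht1] at h1
        obtain ⟨d, hd⟩ := hdiv (W.j (T - (k + 1) - 1))
        refine ⟨c * (Polynomial.X * d + Polynomial.C (W.b (T - (k + 1)) (W.j (T - (k + 1) - 1)))), ?_, ?_⟩
        · rw [Polynomial.mul_coeff_zero, Polynomial.coeff_add, Polynomial.mul_coeff_zero, Polynomial.coeff_X_zero,
            zero_mul, zero_add, Polynomial.coeff_C_zero]
          exact mul_ne_zero hc0 hb
        · rw [arcPt_succ_of_ne W T k hjj, hc, hd, Polynomial.algebraMap_eq]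
          ring

/-- **JET INVARIANT.**  Along a newest-free tail of a forced walk from a root (`q = p^e`), the jet coefficients of
orders `0 < |d| < q` of the level-`(T−k)` transform at the arc point `γ_{T−k}` are divisible by `ε^{k+1}`: each move
DOWN gains a factor `η^q` from the exceptional divisor (`jet_contraction`) and loses `η^{q−1}`, `η = ε·unit`
(`arcPt_dvd`). [new] -/
theorem arcPt_jet (p : ℕ) [Fact p.Prime] [CharP K p] [PerfectRing K p] {e : ℕ} {s₀ : State (Fin 3) K}
    (hs : IsRoot (p ^ e) s₀) (W : ForcedWalk (p ^ e) s₀) (T N : ℕ) (hN : ∀ t, N ≤ t → LeavesNewest W t) :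
    ∀ k, N + 1 + k ≤ T → ∀ d : Fin 3 →₀ ℕ, d ≠ 0 → d.degree < p ^ e →
      Polynomial.X ^ (k + 1) ∣ jetCoeff (arcPt W T k) d (W.st (T - k)).F := by
  classical
  intro k
  induction k with
  | zero =>
    intro hT d hd0 hd
    rw [zero_add, pow_one, Nat.sub_zero]
    refine X_dvd_aeval (arcPt_dvd W T N hN 0 (by omega)).1 ?_
    rw [constantCoeff_hasseDeriv]
    obtain ⟨o, ho, hqo⟩ := ItineraryCutClasses.walk_nat hs W T
    refine Hauser2010.coeff_eq_zero_of_degree_lt_ordZero ?_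
    rw [ho]
    exact_mod_cast lt_of_lt_of_le hd hqo
  | succ k ih =>
    intro hT d hd0 hd
    have ih' := ih (by omega)
    obtain ⟨-, c, hc0, hc⟩ := arcPt_dvd W T N hN k (by omega)
    have ht' : T - k - 1 = T - (k + 1) := by omega
    rw [ht'] at hc
    obtain ⟨h, hchart⟩ := walk_chart p hs W (T - (k + 1))
    have ht1 : T - (k + 1) + 1 = T - k := by omega
    rw [ht1] at hchart
    have hmem := jet_contraction p e (W.j (T - (k + 1))) (W.b (T - (k + 1))) hchart (arcPt W T k)
      (arcPt W T (k + 1)) (arcPt_succ_self W T k) (fun i hi => arcPt_succ_of_ne W T k hi) hd0 hd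
    have hJ : jetIdeal (p ^ e) (arcPt W T k) (W.st (T - k)).F ≤ Ideal.span {Polynomial.X ^ (k + 1)} := by
      rw [jetIdeal, Ideal.span_le]
      rintro _ ⟨d', ⟨hd'0, hd'⟩, rfl⟩
      exact Ideal.mem_span_singleton.mpr (ih' d' hd'0 hd')
    have hmem' := Ideal.mul_mono_right hJ hmem
    rw [Ideal.span_singleton_mul_span_singleton, Ideal.mem_span_singleton, hc] at hmem'
    have hsplit : (Polynomial.X * c) ^ p ^ e = (Polynomial.X * c) ^ (p ^ e - 1) * (Polynomial.X * c) := by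
      rw [← pow_succ, Nat.sub_add_cancel (Nat.one_le_pow _ _ (Fact.out : p.Prime).pos)]
    have hXc : (Polynomial.X * c) ^ (p ^ e - 1) ≠ 0 := by
      refine pow_ne_zero _ (mul_ne_zero Polynomial.X_ne_zero fun h0 => hc0 ?_)
      rw [h0, Polynomial.coeff_zero]
    rw [hsplit, mul_assoc, mul_dvd_mul_iff_left hXc] at hmem'
    calc (Polynomial.X : Polynomial K) ^ (k + 1 + 1) = Polynomial.X * Polynomial.X ^ (k + 1) := by ring
      _ ∣ Polynomial.X * c * Polynomial.X ^ (k + 1) := mul_dvd_mul (dvd_mul_right _ _) dvd_rfl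
      _ ∣ _ := hmem'

/-- **THE ARC LAW (PROVED, port-free kernel proof): a forced walk from a root has no infinite NEWEST-FREE tail**,
for every `q = p^e`.  Endgame: at the tail base `B = N+1` the isolation certificate `g · u_{j_N}^M ∈ topIdeal`
(`g(0) ≠ 0`) evaluated at the arc point `γ_B` pushed down from level `T = B + M` gives
`g(γ_B) · (ε·unit)^M ∈ (ε^{M+1})`, i.e. `ε ∣ g(γ_B)`, i.e. `g(0) = 0`. [new] -/
theorem noFreePointTails_holds : NoFreePointTails := by
  intro p hp e _ K _ _ _ _ s₀ hs W N hN
  classical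
  haveI := Fact.mk hp
  haveI : PerfectRing K p := PerfectField.toPerfectRing p
  obtain ⟨M, g, hg0, hg⟩ := W.isolated (N + 1)
  obtain ⟨hdiv, c, hc0, hc⟩ := arcPt_dvd W (N + 1 + M) N hN M le_rfl
  have hTM1 : N + 1 + M - M - 1 = N := by omega
  rw [hTM1] at hc
  have hJ := arcPt_jet p hs W (N + 1 + M) N hN M le_rfl
  rw [Nat.add_sub_cancel] at hJ
  have hle : jetIdeal (p ^ e) (arcPt W (N + 1 + M) M) (W.st (N + 1)).F ≤
      Ideal.span {(Polynomial.X : Polynomial K) ^ (M + 1)} := by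
    rw [jetIdeal, Ideal.span_le]
    rintro _ ⟨d, ⟨hd0, hd⟩, rfl⟩
    exact Ideal.mem_span_singleton.mpr (hJ d hd0 hd)
  have hdvd := Ideal.mem_span_singleton.mp (hle (aeval_mem_jetIdeal (arcPt W (N + 1 + M) M) (hg (W.j N))))
  rw [map_mul, map_pow, aeval_X, hc] at hdvd
  have hX : Polynomial.X ∣ aeval (arcPt W (N + 1 + M) M) g * c ^ M := by
    have h2 : (Polynomial.X : Polynomial K) ^ M * Polynomial.X ∣
        Polynomial.X ^ M * (aeval (arcPt W (N + 1 + M) M) g * c ^ M) := by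
      rw [← pow_succ, show (Polynomial.X : Polynomial K) ^ M * (aeval (arcPt W (N + 1 + M) M) g * c ^ M) =
        aeval (arcPt W (N + 1 + M) M) g * (Polynomial.X * c) ^ M by ring]
      exact hdvd
    exact (mul_dvd_mul_iff_left (pow_ne_zero M Polynomial.X_ne_zero)).mp h2
  have h0 := Polynomial.X_dvd_iff.mp hX
  rw [Polynomial.coeff_zero_eq_eval_zero, Polynomial.eval_mul, Polynomial.eval_pow] at h0
  have hc0' : Polynomial.eval 0 c ≠ 0 := by rwa [← Polynomial.coeff_zero_eq_eval_zero]
  have hg' := (mul_eq_zero.mp h0).resolve_right (pow_ne_zero M hc0')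
  rw [← Polynomial.coeff_zero_eq_eval_zero, coeff_zero_aeval_of_X_dvd hdiv] at hg'
  exact hg0 hg'

/-- Hence the all-`e` DEEP form (`ProximityCutKernels.freeTailsDeep_of_all`). [new] -/
theorem noFreePointTailsDeep_holds : NoFreePointTailsDeep :=
  freeTailsDeep_of_all noFreePointTails_holds

end Walk

end Summit.ResolutionOfSingularities.ResolutionOfSingularities.Theorems.ProximityCut
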